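import Mathlib
import Summits.CriticalPhenomena.SAWScalingLimit.Theses.SAWDefectDecoherence
import Literature.Probability.RandomPlanarGeometry.RadoContinuitySLE
import Literature.Probability.RandomPlanarGeometry.ChordalUniformizerConvergence
import Literature.Probability.RandomPlanarGeometry.CrossRatioContinuity
import Literature.Probability.RandomPlanarGeometry.SLEExistenceNeEightHolds
import Literature.Probability.RandomPlanarGeometry.SLEUniquenessInLaw

/-!
# Radó continuity of the chordal SLE(8/3) law, uniform form at a fixed target domain

Stub `stub_sleLawContinuity` (typed statement `SLELawContinuity`) of the line `bridge-gate-renewal`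
for the crux `Summit.CriticalPhenomena.SAWScalingLimit.Theses.SAWDefectDecoherence.ObservableToSLER`
(item `stmt-CriticalPhenomena-14005`).

**Statement.** For every Dobrushin domain `(D; a, b)`, every bounded continuous
`f : CurveClass ℂ → ℝ` and every `ε > 0` there is `η > 0` such that: whenever a Dobrushin domain
`M` has its boundary loop uniformly `η`-close to that of `D` (same parameter) and its two marked
points `η`-close to `a`, `b`, every chordal SLE(8/3) law `μ` of `M` and every chordal SLE(8/3) law
`ν` of `D` satisfy `|∫ f dμ - ∫ f dν| ≤ ε`.

**Proof** (all ingredients are PROVED facts of the tree). Suppose not, and pick `M_n`, `μ_n`, `ν_n`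
with `‖M_n.boundary - D.boundary‖_∞ ≤ 1/(n+1)`, marks `1/(n+1)`-close and
`|∫ f dμ_n - ∫ f dν_n| > ε`.
* The SLE(8/3) law of a Dobrushin domain exists (`exists_isSLELaw_of_ne_eight`, Rohde–Schramm) and
  is unique (`IsSLELaw.unique'`, Lawler 2005 §6.1); let `Q E` be the SLE(8/3) law of `E`, a chordal
  family with `Q (M_n) = μ_n`, `Q D = ν_n`.
* `Q` is Radó-continuous (`ChordalFamily.isRadoContinuous_of_forall_isSLELaw`): along continuous
  maps `Φ_n → Φ : ℂ → ℂ`, uniformly on the closed unit disc, conformal on the disc and injective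
  on the closed disc, `Q (Φ_n 𝔻; Φ_n 1, Φ_n (-1)) ⇀ Q (Φ 𝔻; Φ 1, Φ (-1))` weakly.
* Such maps with `Φ_n 𝔻 = M_n`, `Φ 𝔻 = D` and the right marks exist by RADÓ'S THEOREM
  (Pommerenke 1992 Thm. 2.11, tree `JordanDomain.rado_tendstoUniformlyOn_holds`) in the chordal
  form `MarkedDomain.exists_uniformizers_of_tendstoUniformly_boundary`
  (`ChordalUniformizerConvergence.lean`): a point `z₀ ∈ D` lies in `M_n` for large `n`
  (`JordanDomain.eventually_mem_carrier_of_tendstoUniformly`, winding numbers), and chordal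
  uniformizing maps `φ_n : ℍ → M_n`, `φ : ℍ → D` (`0 ↦ a`, `∞ ↦ b`) normalised at `z₀` converge
  uniformly on `ℍ`; composing with the Cayley map `𝔻 → ℍ` and taking Carathéodory extensions
  (`JordanDomain.exists_continuousOn_extension_holds`, Pommerenke Thm. 2.6) gives `Ψ_n → Ψ`
  uniformly on the closed disc (density, `tendstoUniformlyOn_of_subset_closure`) with
  `Ψ_n (-1) = a_n`, `Ψ_n 1 = b_n`; finally `Φ_n z = Ψ_n (-(r z))` with `r` the radial retraction
  of `ℂ` onto the closed disc is continuous on `ℂ`, and the parameter domain is the unit disc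
  Dobrushin domain `(𝔻; 1, -1)`.
* Hence `∫ f dμ_n → ∫ f dν_0`, contradicting `|∫ f dμ_n - ∫ f dν_n| > ε` (`ν_n = ν_0`).

References: Ch. Pommerenke, *Boundary Behaviour of Conformal Maps* (1992), Thm. 2.6, Thm. 2.11;
G. F. Lawler, *Conformally Invariant Processes in the Plane* (2005), §6.1, §6.3.
-/

noncomputable section

open scoped BigOperators Topology NNReal ENNReal Classical BoundedContinuousFunction
open Filter Set MeasureTheory Metric
open Literature.Probability.LatticeModels (HexVertex hexGraph hexCenter triZeta Site)
open Literature.Probability.RandomPlanarGeometry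
open Literature.Probability.RandomPlanarGeometry.SAW
open UpperHalfPlane (upperHalfPlaneSet)

namespace Summit.CriticalPhenomena.SAWScalingLimit.Theorems.ObservableToSLER.BridgeGate

/-! ### The unit disc Dobrushin domain `(𝔻; 1, -1)` -/

/-- The carrier of the unit disc Dobrushin domain is the open unit ball. [folklore] -/
private theorem unitDisc_carrier : DobrushinDomain.unitDisc.carrier = ball (0 : ℂ) 1 := rfl

/-- The closure of the carrier of the unit disc Dobrushin domain is the closed unit ball. [folklore] -/
private theorem closure_unitDisc_carrier :
    closure DobrushinDomain.unitDisc.carrier = closedBall (0 : ℂ) 1 := by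
  rw [unitDisc_carrier, closure_ball (0 : ℂ) one_ne_zero]

/-- The first marked point of the unit disc Dobrushin domain is `1`. [folklore] -/
private theorem unitDisc_pt_zero : DobrushinDomain.unitDisc.pt 0 = 1 := by
  simp [MarkedDomain.pt, DobrushinDomain.unitDisc, JordanDomain.unitDisc, circleMap]

/-- The second marked point of the unit disc Dobrushin domain is `-1`. [folklore] -/
private theorem unitDisc_pt_one : DobrushinDomain.unitDisc.pt 1 = -1 := by
  have h : DobrushinDomain.unitDisc.pt 1 = circleMap 0 1 (2 * Real.pi * (1 / 2)) := rfl
  rw [h, circleMap]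
  have : ((2 * Real.pi * (1 / 2) : ℝ) : ℂ) * Complex.I = Real.pi * Complex.I := by push_cast; ring
  rw [this, Complex.exp_pi_mul_I]
  simp

/-! ### A continuous retraction of the plane onto the closed unit disc -/

/-- There is a continuous retraction of `ℂ` onto the closed unit disc
(`z ↦ z / max 1 |z|`). [folklore] -/
private theorem exists_retraction_closedBall :
    ∃ r : ℂ → ℂ, Continuous r ∧ (∀ z, r z ∈ closedBall (0 : ℂ) 1) ∧
      ∀ z ∈ closedBall (0 : ℂ) 1, r z = z := by
  have hpos : ∀ z : ℂ, 0 < max 1 ‖z‖ := fun z ↦ lt_of_lt_of_le one_pos (le_max_left _ _)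
  refine ⟨fun z ↦ ((max 1 ‖z‖)⁻¹ : ℝ) • z, ?_, ?_, ?_⟩
  · have h : Continuous fun z : ℂ ↦ max 1 ‖z‖ := continuous_const.max continuous_norm
    exact (h.inv₀ fun z ↦ (hpos z).ne').smul continuous_id
  · intro z
    rw [mem_closedBall_zero_iff, norm_smul, norm_inv, Real.norm_of_nonneg (hpos z).le,
      inv_mul_le_iff₀ (hpos z), mul_one]
    exact le_max_right _ _
  · intro z hz
    rw [mem_closedBall_zero_iff] at hz
    simp [max_eq_left hz]

/-! ### Disc charts of a Dobrushin domain from a chordal uniformizing map -/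

/-- **Disc chart of a Dobrushin domain.** Given a chordal uniformizing map `φ : ℍ → E`
(`0 ↦ E.pt 0`, `∞ ↦ E.pt 1`) and a continuous retraction `r` of `ℂ` onto the closed unit disc,
let `Ψ` be the Carathéodory extension of `φ ∘ C⁻¹ : 𝔻 → E` (`C` the Cayley map,
`JordanDomain.exists_continuousOn_extension_holds`, Pommerenke 1992 Thm. 2.6). Then
`Φ z = Ψ (-(r z))` is continuous on `ℂ`, conformal on `𝔻`, injective on the closed disc, maps `𝔻`
onto `E`, and `Φ 1 = Ψ (-1) = E.pt 0` (`C 0 = -1`), `Φ (-1) = Ψ 1 = E.pt 1` (`C ∞ = 1`).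
[cite: PommerenkeBBCM1992, Thm. 2.6] -/
private theorem exists_discChart (E : DobrushinDomain)
    (φ : ConformalEquiv upperHalfPlaneSet E.carrier) (hφ : E.IsChordalUniformizing φ)
    {r : ℂ → ℂ} (hr : Continuous r) (hrm : ∀ z, r z ∈ closedBall (0 : ℂ) 1)
    (hre : ∀ z ∈ closedBall (0 : ℂ) 1, r z = z) :
    ∃ (Ψ : ℂ → ℂ) (Φ : C(ℂ, ℂ)), ContinuousOn Ψ (closedBall 0 1) ∧
      EqOn Ψ (cayley.symm.trans φ) (ball 0 1) ∧ (∀ z, Φ z = Ψ (-(r z))) ∧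
      DifferentiableOn ℂ Φ (ball 0 1) ∧ InjOn Φ (closedBall 0 1) ∧
      E.carrier = Φ '' ball 0 1 ∧ E.pt 0 = Φ 1 ∧ E.pt 1 = Φ (-1) := by
  obtain ⟨Ψ, hΨc, hΨeq, hΨbij, -⟩ :=
    JordanDomain.exists_continuousOn_extension_holds E.toJordanDomain (cayley.symm.trans φ)
  set g : ConformalEquiv (ball (0 : ℂ) 1) E.carrier := cayley.symm.trans φ with hg
  have hneg_cb : ∀ {z : ℂ}, z ∈ closedBall (0 : ℂ) 1 → -z ∈ closedBall (0 : ℂ) 1 := fun hz ↦ by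
    simpa using hz
  have hneg_b : ∀ {z : ℂ}, z ∈ ball (0 : ℂ) 1 → -z ∈ ball (0 : ℂ) 1 := fun hz ↦ by
    simpa using hz
  have hcont : Continuous fun z ↦ Ψ (-(r z)) :=
    hΨc.comp_continuous hr.neg fun z ↦ hneg_cb (hrm z)
  refine ⟨Ψ, ⟨fun z ↦ Ψ (-(r z)), hcont⟩, hΨc, hΨeq, fun z ↦ rfl, ?_, ?_, ?_, ?_, ?_⟩
  · -- conformal on the open disc: there `Φ z = g (-z)`
    have h1 : DifferentiableOn ℂ (fun z ↦ g (-z)) (ball 0 1) :=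
      g.differentiableOn.comp differentiable_neg.differentiableOn fun z hz ↦ hneg_b hz
    refine h1.congr fun z hz ↦ ?_
    show Ψ (-(r z)) = g (-z)
    rw [hre z (ball_subset_closedBall hz), hΨeq (hneg_b hz)]
  · -- injective on the closed disc
    intro z₁ hz₁ z₂ hz₂ h
    change Ψ (-(r z₁)) = Ψ (-(r z₂)) at h
    rw [hre z₁ hz₁, hre z₂ hz₂] at h
    exact neg_injective (hΨbij.injOn (hneg_cb hz₁) (hneg_cb hz₂) h)
  · -- the image of the open disc is the carrier
    ext w
    constructor
    · intro hw
      have hu : g.symm w ∈ ball (0 : ℂ) 1 := g.symm_mapsTo hw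
      refine ⟨-(g.symm w), hneg_b hu, ?_⟩
      show Ψ (-(r (-(g.symm w)))) = w
      rw [hre _ (ball_subset_closedBall (hneg_b hu)), neg_neg, hΨeq hu, g.apply_symm_apply hw]
    · rintro ⟨z, hz, rfl⟩
      show Ψ (-(r z)) ∈ E.carrier
      rw [hre z (ball_subset_closedBall hz), hΨeq (hneg_b hz)]
      exact g.mapsTo (hneg_b hz)
  · -- `Φ 1 = Ψ (-1) = Ψ (C 0) = E.pt 0`
    haveI := neBot_nhdsWithin_upperHalfPlaneSet_zero
    have h1 : Tendsto φ (𝓝[upperHalfPlaneSet] 0) (𝓝 (Ψ (cayleyFun 0))) :=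
      JordanDomain.tendsto_nhdsWithin_of_extension φ hΨc hΨeq (x := 0) (by simp)
    have hc0 : cayleyFun 0 = -1 := by
      rw [cayleyFun_apply, zero_sub, zero_add, neg_div, div_self Complex.I_ne_zero]
    have h0 : Tendsto φ (𝓝[upperHalfPlaneSet] 0) (𝓝 (E.pt 0)) := hφ.1
    show E.pt 0 = Ψ (-(r 1))
    rw [hre 1 (by simp), ← hc0]
    exact tendsto_nhds_unique h0 h1
  · -- `Φ (-1) = Ψ 1 = Ψ (C ∞) = E.pt 1`
    haveI := neBot_cocompact_inf_principal_upperHalfPlaneSet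
    have h1 : Tendsto φ (cocompact ℂ ⊓ 𝓟 upperHalfPlaneSet) (𝓝 (Ψ 1)) :=
      JordanDomain.tendsto_cocompact_of_extension φ hΨc hΨeq
    have h0 : Tendsto φ (cocompact ℂ ⊓ 𝓟 upperHalfPlaneSet) (𝓝 (E.pt 1)) := hφ.2
    show E.pt 1 = Ψ (-(r (-1)))
    rw [hre (-1) (by simp), neg_neg]
    exact tendsto_nhds_unique h0 h1

/-! ### The stub -/

/-- **RADÓ CONTINUITY OF THE SLE(8/3) LAW, uniform form at a fixed target** (the typed statement
`SLELawContinuity` of the line `bridge-gate-renewal`). For every Dobrushin domain `D`, bounded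
continuous `f` and `ε > 0` there is `η > 0` such that every Dobrushin domain whose boundary loop is
uniformly `η`-close to that of `D` (same parameter) and whose two marked points are `η`-close to
those of `D` has its chordal SLE(8/3) law `ε`-close to that of `D` against `f`. Proof by
contradiction along a sequence `M_n`: the SLE(8/3) laws form a Radó-continuous chordal family
(`ChordalFamily.isRadoContinuous_of_forall_isSLELaw`; existence `exists_isSLELaw_of_ne_eight`,
uniqueness `IsSLELaw.unique'`), and Radó's theorem (Pommerenke 1992 Thm. 2.11, tree
`JordanDomain.rado_tendstoUniformlyOn_holds` through
`MarkedDomain.exists_uniformizers_of_tendstoUniformly_boundary`) with Carathéodory's theorem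
(Thm. 2.6) supplies disc charts `Φ_n → Φ` of `M_n → D` converging uniformly on the closed disc with
the marks at `Φ_n (±1)`; so `∫ f dμ_n → ∫ f dν`, a contradiction.
[cite: PommerenkeBBCM1992, Thm. 2.11] -/
theorem stub_sleLawContinuity :
    ∀ (D : DobrushinDomain) (f : CurveClass ℂ →ᵇ ℝ) (ε : ℝ), 0 < ε → ∃ η > (0 : ℝ),
      ∀ (M : DobrushinDomain), (∀ t : ℝ, dist (M.boundary t) (D.boundary t) ≤ η) →
        dist (M.pt 0) (D.pt 0) ≤ η → dist (M.pt 1) (D.pt 1) ≤ η →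
        ∀ μ ν : Measure (CurveClass ℂ), IsSLELaw ((8 : ℝ≥0) / 3) M μ → IsSLELaw ((8 : ℝ≥0) / 3) D ν →
          |∫ x, f x ∂μ - ∫ x, f x ∂ν| ≤ ε := by
  intro D f ε hε
  by_contra H
  push Not at H
  choose M hMb hM0 hM1 μ ν hμ hν hgap using
    fun n : ℕ ↦ H (1 / ((n : ℝ) + 1)) (by positivity)
  -- the chordal SLE(8/3) family
  have h83 : (0 : ℝ≥0) < 8 / 3 := by positivity
  have h83' : (8 / 3 : ℝ≥0) ≠ 8 := by norm_num
  set Q : ChordalFamily := fun E ↦ Classical.choose (exists_isSLELaw_of_ne_eight h83 h83' E)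
    with hQ_def
  have hQ : ∀ E : DobrushinDomain, IsSLELaw ((8 : ℝ≥0) / 3) E (Q E) := fun E ↦
    Classical.choose_spec (exists_isSLELaw_of_ne_eight h83 h83' E)
  have hQM : ∀ n, Q (M n) = μ n := fun n ↦ (hQ (M n)).unique' (hμ n)
  have hQD : ∀ n, Q D = ν n := fun n ↦ (hQ D).unique' (hν n)
  have hR : Q.IsRadoContinuous := ChordalFamily.isRadoContinuous_of_forall_isSLELaw hQ
  -- the boundary loops converge uniformly and the marked points converge
  have h0 : Tendsto (fun n : ℕ ↦ 1 / ((n : ℝ) + 1)) atTop (𝓝 0) :=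
    tendsto_one_div_add_atTop_nhds_zero_nat
  have hJ : TendstoUniformly (fun n ↦ (M n).boundary) D.boundary atTop := by
    rw [Metric.tendstoUniformly_iff]
    intro δ hδ
    filter_upwards [(tendsto_order.1 h0).2 δ hδ] with n hn t
    rw [dist_comm]
    exact (hMb n t).trans_lt hn
  have ha : Tendsto (fun n ↦ (M n).pt 0) atTop (𝓝 (D.pt 0)) :=
    tendsto_iff_dist_tendsto_zero.2
      (squeeze_zero (fun n ↦ dist_nonneg) (fun n ↦ hM0 n) h0)
  have hb : Tendsto (fun n ↦ (M n).pt 1) atTop (𝓝 (D.pt 1)) :=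
    tendsto_iff_dist_tendsto_zero.2
      (squeeze_zero (fun n ↦ dist_nonneg) (fun n ↦ hM1 n) h0)
  -- Radó: chordal uniformizing maps converging uniformly on `ℍ`
  obtain ⟨z₀, hz₀⟩ := D.nonempty
  have hz₀n : ∀ᶠ n in atTop, z₀ ∈ (M n).carrier :=
    JordanDomain.eventually_mem_carrier_of_tendstoUniformly
      (D := fun n ↦ (M n).toJordanDomain) (Dlim := D.toJordanDomain) hJ hz₀
  obtain ⟨φ, φs, hφ, hφs, hU1, -, -⟩ :=
    MarkedDomain.exists_uniformizers_of_tendstoUniformly_boundary hJ ha hb hz₀ hz₀n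
  have hH : TendstoUniformlyOn (fun n ↦ (φs n : ℂ → ℂ)) φ atTop upperHalfPlaneSet :=
    ((hU1.mono fun z (hz : 0 < z.im) ↦ hz.le).congr
      (Eventually.of_forall fun n z hz ↦ (φs n).boundaryExtension_eq hz)).congr_right
      fun z hz ↦ φ.boundaryExtension_eq hz
  -- disc charts
  obtain ⟨r, hr, hrm, hre⟩ := exists_retraction_closedBall
  choose Ψs Φs hΨsc hΨseq hΦs hΦsd hΦsi hcars hpt0s hpt1s using
    fun n ↦ exists_discChart (M n) (φs n) (hφs n) hr hrm hre
  obtain ⟨Ψl, Φl, hΨlc, hΨleq, hΦl, hΦld, hΦli, hcarl, hpt0l, hpt1l⟩ :=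
    exists_discChart D φ hφ hr hrm hre
  -- the charts converge uniformly on the closed disc
  have hΨball : TendstoUniformlyOn Ψs Ψl atTop (ball (0 : ℂ) 1) := by
    have h2 : TendstoUniformlyOn (fun n ↦ (φs n : ℂ → ℂ) ∘ cayleyInvFun) (φ ∘ cayleyInvFun) atTop
        (ball (0 : ℂ) 1) :=
      (hH.comp cayleyInvFun).mono fun w hw ↦ cayley.symm_mapsTo hw
    refine (h2.congr (Eventually.of_forall fun n w hw ↦ ?_)).congr_right fun w hw ↦ ?_
    · exact (hΨseq n hw).symm
    · exact (hΨleq hw).symm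
  have hΨunif : TendstoUniformlyOn Ψs Ψl atTop (closedBall (0 : ℂ) 1) := by
    refine tendstoUniformlyOn_of_subset_closure ?_ ball_subset_closedBall
      (Eventually.of_forall hΨsc) hΨlc hΨball
    rw [closure_ball (0 : ℂ) one_ne_zero]
  have hΦunif : TendstoUniformlyOn (fun n ↦ ⇑(Φs n)) Φl atTop
      (closure DobrushinDomain.unitDisc.carrier) := by
    rw [Metric.tendstoUniformlyOn_iff]
    intro δ hδ
    filter_upwards [Metric.tendstoUniformlyOn_iff.1 hΨunif δ hδ] with n hn z _
    rw [hΦl z, hΦs n z]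
    exact hn _ (by simpa using hrm z)
  -- Radó continuity of the SLE(8/3) family along the charts
  have hlim : Tendsto (fun n ↦ ∫ x, f x ∂(Q (M n))) atTop (𝓝 (∫ x, f x ∂(Q D))) := by
    refine hR DobrushinDomain.unitDisc D M Φl Φs hΦunif ?_ ?_ (fun n ↦ ⟨?_, ?_⟩) ?_ ?_ ?_
      (fun n ↦ ⟨?_, ?_, ?_⟩) f
    · rw [unitDisc_carrier]; exact hΦld
    · rw [closure_unitDisc_carrier]; exact hΦli
    · rw [unitDisc_carrier]; exact hΦsd n
    · rw [closure_unitDisc_carrier]; exact hΦsi n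
    · rw [unitDisc_carrier]; exact hcarl
    · rw [unitDisc_pt_zero]; exact hpt0l
    · rw [unitDisc_pt_one]; exact hpt1l
    · rw [unitDisc_carrier]; exact hcars n
    · rw [unitDisc_pt_zero]; exact hpt0s n
    · rw [unitDisc_pt_one]; exact hpt1s n
  -- contradiction
  simp only [hQM] at hlim
  obtain ⟨n, hn⟩ := ((Metric.tendsto_nhds.1 hlim) ε hε).exists
  rw [Real.dist_eq] at hn
  have h := hgap n
  rw [← hQD n] at h
  exact absurd hn (not_lt.2 h.le)

end Summit.CriticalPhenomena.SAWScalingLimit.Theorems.ObservableToSLER.BridgeGate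

end
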